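import Summits.NavierStokesRegularity.OSWSelfSimilar.SheetNSLineTorusCascade
import HarnessLib

/-!
# Viscous CLM on the torus (`a = 0`, `σ = 2`): the POLE TAIL LEMMA — a pole lower bound on finitely many modes over a time
# window propagates to ALL modes (the kernel half of the interval certificate for the blow-up threshold)

HONEST FRAMING (cell ns-blowup GROUP B «PROFILE SEARCH», zone Z3, row Z3-U addendum A-F2 of `HOME/profile/z3/CENSUS-Z3.md`;
human rulings D-0035/D-0074): **1-D MODEL (viscous Constantin–Lax–Majda equation `ω_t = ω Hω + ν ω_xx` on `𝕋 = ℝ/2πℤ`);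
ODE calculus on Fourier-coefficient families, kernel-checked; not Euler, not Navier–Stokes; «violates: none — MODEL».**

OBJECT: the sine-datum cascade `IsSineCascade ν c e` (`SheetNSLineTorusCascade`). There `lower_step`/`pole_lower_bound` started the
pole comparison at mode `1` (forced amplitude `24ν`, constant `48`). HERE the same window mechanism with a GENERAL pole profile
`m_j(s) = A j r^j e^{−νjs}` started at an arbitrary mode `k₀` over a bounded window `[α, T]`:

* `tail_step` — if the modes `j < k` dominate `m_j` on `[α, T]` and `12νk ≤ A(k+1)(1 − e^{−ν(k²−k)τ})`, then mode `k` dominates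
  `m_k` on `[α + τ, T]`;
* `tail_induction` — **if `12ν ≤ A(1 − e^{−L})` (`L > 0`) and the modes `j ≤ k₀` dominate `m_j` on `[α, T]`, then EVERY mode `k`
  dominates `m_k` on `[α + L/(νk₀), T]`** (windows `L/(νk(k−1))`, `k > k₀`, telescoping);
* `unbounded_of_base` — if moreover `r e^{−νt₁} ≥ 1` at `t₁ = α + L/(νk₀) ≤ T`, the coefficients `k ↦ c_k(t₁)` are unbounded
  (`≥ A k`): **blow-up by `t₁`**.
USE (the certificate, `HOME/profile/z3/SHEET.md` §15): interval arithmetic gives rigorous lower bounds `e_j(s) ≥ ℓ_j(s)` for the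
UNIVERSAL cascade (`c = ν = 1`) on `j ≤ k₀`, `s ∈ [α, T]`; with `r* := min_{j,s} (ℓ_j(s)e^{js}/(Aj))^{1/j}` the base holds for the
datum `c` with `r = c·r*` (`c_k^{(c)} = c^k e_k`), so **every `c > e^{t₁}/r*` blows up** — this file is the kernel half of that
sentence; the numbers (`A = 12(1+δ)`, `L = log((1+δ)/δ)`, `C_HI = e^{t₁}/r*`) live in the certificate. bears_on: LADDER-NS N5 / zone Z3
(row Z3-U) → N1 linear core. WHAT THIS IS NOT: not NS; the base hypothesis is NOT proved here (it is the certified-numerics input);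
nothing about data other than the sine datum. No definitions.
-/

namespace Summit.NavierStokesRegularity.OSWSelfSimilar
namespace SheetNSLineTorusCascade

open Finset Real Set

variable {ν c : ℝ} {e : ℕ → ℝ → ℝ}

/-- Convolution of the general pole profile `A j r^j e^{−νjs}`: `Σ_{i+j=k} m_i m_j = (A²/6)(k³ − k) r^k e^{−νks}`
(`SheetNSLineSchochetCornerTorus.torusCorner_coeff_identity` with `ν′ = A/12`). [new here — MODEL] -/
theorem generalPole_conv (ν A r : ℝ) (k : ℕ) (s : ℝ) :
    ∑ p ∈ antidiagonal k, (A * (p.1 : ℝ) * r ^ p.1 * exp (-(ν * (p.1 : ℝ) * s)))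
        * (A * (p.2 : ℝ) * r ^ p.2 * exp (-(ν * (p.2 : ℝ) * s)))
      = A ^ 2 / 6 * ((k : ℝ) ^ 3 - k) * r ^ k * exp (-(ν * (k : ℝ) * s)) := by
  have key := SheetNSLineSchochetCornerTorus.torusCorner_coeff_identity (A / 12) (r * exp (-(ν * s))) k
  have hrw : ∀ q : ℕ × ℕ, q ∈ antidiagonal k →
      (A * (q.1 : ℝ) * r ^ q.1 * exp (-(ν * (q.1 : ℝ) * s))) * (A * (q.2 : ℝ) * r ^ q.2 * exp (-(ν * (q.2 : ℝ) * s)))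
        = (12 * (A / 12) * (q.1 : ℝ) * (r * exp (-(ν * s))) ^ q.1) * (12 * (A / 12) * (q.2 : ℝ) * (r * exp (-(ν * s))) ^ q.2) := by
    intro q _
    have h1 : exp (-(ν * (q.1 : ℝ) * s)) = exp (-(ν * s)) ^ q.1 := by rw [← exp_nat_mul]; congr 1; ring
    have h2 : exp (-(ν * (q.2 : ℝ) * s)) = exp (-(ν * s)) ^ q.2 := by rw [← exp_nat_mul]; congr 1; ring
    rw [h1, h2, mul_pow, mul_pow]; ring
  rw [sum_congr rfl hrw]
  have hk : exp (-(ν * (k : ℝ) * s)) = exp (-(ν * s)) ^ k := by rw [← exp_nat_mul]; congr 1; ring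
  rw [hk]
  have h2 : 12 * (A / 12) * (k : ℝ) * (r * exp (-(ν * s))) ^ k = A * (k : ℝ) * (r * exp (-(ν * s))) ^ k := by ring
  rw [h2, mul_pow] at key
  have h3 : (A / 12) * (k : ℝ) ^ 2 * (A * (k : ℝ) * (r ^ k * exp (-(ν * s)) ^ k))
      + (-(A / 12) * (A * (k : ℝ) * (r ^ k * exp (-(ν * s)) ^ k)))
      = (1 / 2) * (A ^ 2 / 6 * ((k : ℝ) ^ 3 - k) * r ^ k * exp (-(ν * s)) ^ k) := by ring
  linarith

/-- **TAIL STEP.** Let `k ≥ 2`, `0 ≤ α`, `0 < τ`, `0 < A`, `0 ≤ r`, and suppose `12νk ≤ A(k+1)(1 − e^{−ν(k²−k)τ})`. If every mode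
`j < k` satisfies `A j r^j e^{−νjs} ≤ e_j(s)` for `s ∈ [α, T]`, then `A k r^k e^{−νkt} ≤ e_k(t)` for `t ∈ [α + τ, T]`.
[new here — MODEL] -/
theorem tail_step (he : IsSineCascade ν c e) (hν : 0 < ν) (hc : 0 ≤ c) {A r α T τ : ℝ} (hA : 0 < A) (hr : 0 ≤ r)
    (hα : 0 ≤ α) (hτ : 0 < τ) {k : ℕ} (hk : 2 ≤ k)
    (hcond : 12 * ν * (k : ℝ) ≤ A * ((k : ℝ) + 1) * (1 - exp (-(ν * ((k : ℝ) ^ 2 - k) * τ))))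
    (hyp : ∀ j, j < k → ∀ s ∈ Icc α T, A * (j : ℝ) * r ^ j * exp (-(ν * (j : ℝ) * s)) ≤ e j s) :
    ∀ t ∈ Icc (α + τ) T, A * (k : ℝ) * r ^ k * exp (-(ν * (k : ℝ) * t)) ≤ e k t := by
  intro t ht
  have hk1 : (1 : ℝ) < k := by exact_mod_cast hk
  have hkk : 0 < (k : ℝ) ^ 2 - k := by nlinarith
  have hαt : α < t := by linarith [ht.1]
  have htT : t ≤ T := ht.2
  set B : ℝ := A ^ 2 * ((k : ℝ) + 1) * r ^ k / (12 * ν) with hB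
  have hB0 : 0 ≤ B := by positivity
  set G : ℝ → ℝ := fun s => B * exp (ν * ((k : ℝ) ^ 2 - k) * s) with hG
  have hG' : ∀ s, HasDerivAt G (B * (exp (ν * ((k : ℝ) ^ 2 - k) * s) * (ν * ((k : ℝ) ^ 2 - k)))) s := by
    intro s
    have := ((hasDerivAt_id s).const_mul (ν * ((k : ℝ) ^ 2 - k))).exp.const_mul B
    simpa using this
  have hGconv : ∀ s, B * (exp (ν * ((k : ℝ) ^ 2 - k) * s) * (ν * ((k : ℝ) ^ 2 - k)))
      = exp (ν * (k : ℝ) ^ 2 * s) * ((1 / 2) * ∑ p ∈ antidiagonal k,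
          (A * (p.1 : ℝ) * r ^ p.1 * exp (-(ν * (p.1 : ℝ) * s))) * (A * (p.2 : ℝ) * r ^ p.2 * exp (-(ν * (p.2 : ℝ) * s)))) := by
    intro s
    rw [generalPole_conv]
    have hsplit : exp (ν * ((k : ℝ) ^ 2 - k) * s) = exp (ν * (k : ℝ) ^ 2 * s) * exp (-(ν * (k : ℝ) * s)) := by
      rw [← exp_add]; congr 1; ring
    rw [hsplit, hB]
    have h3 : ((k : ℝ) ^ 3 - k) = ((k : ℝ) ^ 2 - k) * ((k : ℝ) + 1) := by ring
    rw [h3]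
    field_simp
    ring
  -- termwise domination on (α, T]
  have hterm : ∀ s, α < s → s ≤ T → ∀ p ∈ antidiagonal k,
      (A * (p.1 : ℝ) * r ^ p.1 * exp (-(ν * (p.1 : ℝ) * s))) * (A * (p.2 : ℝ) * r ^ p.2 * exp (-(ν * (p.2 : ℝ) * s)))
        ≤ e p.1 s * e p.2 s := by
    intro s hs hsT p hp
    have hsum : p.1 + p.2 = k := mem_antidiagonal.mp hp
    rcases Nat.eq_zero_or_pos p.1 with h1 | h1
    · rw [h1, he.zero]; simp
    rcases Nat.eq_zero_or_pos p.2 with h2 | h2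
    · rw [h2, he.zero]; simp
    exact mul_le_mul (hyp p.1 (by omega) s ⟨hs.le, hsT⟩) (hyp p.2 (by omega) s ⟨hs.le, hsT⟩) (by positivity)
      (le_trans (by positivity) (hyp p.1 (by omega) s ⟨hs.le, hsT⟩))
  -- φ = D − G non-decreasing on [α, T]
  set D : ℝ → ℝ := fun s => exp (ν * (k : ℝ) ^ 2 * s) * e k s with hD
  have hφmono : MonotoneOn (fun s => D s - G s) (Icc α T) := by
    refine monotoneOn_of_hasDerivWithinAt_nonneg
      (f' := fun s => exp (ν * (k : ℝ) ^ 2 * s) * ((1 / 2) * ∑ p ∈ antidiagonal k, e p.1 s * e p.2 s)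
        - B * (exp (ν * ((k : ℝ) ^ 2 - k) * s) * (ν * ((k : ℝ) ^ 2 - k))))
      (convex_Icc α T) ?_ (fun s hs => ?_) (fun s hs => ?_)
    · exact ((continuousOn_weighted he k).mono (fun s hs => le_trans hα hs.1)).sub
        ((continuous_const.mul (continuous_exp.comp (continuous_const.mul continuous_id))).continuousOn)
    · rw [interior_Icc] at hs ⊢
      exact ((hasDerivAt_weighted he k (lt_of_le_of_lt hα hs.1)).sub (hG' s)).hasDerivWithinAt
    · rw [interior_Icc] at hs
      rw [hGconv s, ← mul_sub, ← mul_sub]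
      refine mul_nonneg (exp_pos _).le (mul_nonneg (by norm_num) ?_)
      rw [sub_nonneg]
      exact sum_le_sum (hterm s hs.1 hs.2.le)
  have hDα : 0 ≤ D α := mul_nonneg (exp_pos _).le (nonneg he hc k α hα)
  have hαT : α ≤ T := le_trans hαt.le htT
  have hmain : G t - G α ≤ D t := by
    have := hφmono ⟨le_rfl, hαT⟩ ⟨hαt.le, htT⟩ hαt.le
    simp only at this
    linarith
  -- the window: G α ≤ e^{−ν(k²−k)τ} G t
  set x : ℝ := ν * ((k : ℝ) ^ 2 - k) * τ with hx
  have hwin : G α ≤ exp (-x) * G t := by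
    show B * exp (ν * ((k : ℝ) ^ 2 - k) * α) ≤ exp (-x) * (B * exp (ν * ((k : ℝ) ^ 2 - k) * t))
    have h1 : exp (ν * ((k : ℝ) ^ 2 - k) * α) ≤ exp (-x) * exp (ν * ((k : ℝ) ^ 2 - k) * t) := by
      rw [← exp_add]
      apply exp_le_exp.mpr
      have : ν * ((k : ℝ) ^ 2 - k) * (t - α) ≥ x := by
        rw [hx]; exact mul_le_mul_of_nonneg_left (by linarith [ht.1]) (by positivity)
      linarith
    nlinarith [hB0, mul_le_mul_of_nonneg_left h1 hB0]
  have hDlow : (1 - exp (-x)) * G t ≤ D t := by nlinarith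
  -- conclude
  have hGt : G t = B * exp (ν * ((k : ℝ) ^ 2 - k) * t) := rfl
  have hek : e k t = exp (-(ν * (k : ℝ) ^ 2 * t)) * D t := by
    show e k t = exp (-(ν * (k : ℝ) ^ 2 * t)) * (exp (ν * (k : ℝ) ^ 2 * t) * e k t)
    rw [← mul_assoc, ← exp_add]; simp
  rw [hek]
  have hE : 0 < exp (-(ν * (k : ℝ) ^ 2 * t)) := exp_pos _
  have hstep2 : exp (-(ν * (k : ℝ) ^ 2 * t)) * ((1 - exp (-x)) * G t)
      ≤ exp (-(ν * (k : ℝ) ^ 2 * t)) * D t := mul_le_mul_of_nonneg_left hDlow hE.le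
  refine le_trans ?_ hstep2
  -- A k r^k e^{−νkt} ≤ e^{−νk²t}(1 − e^{−x}) B e^{ν(k²−k)t}  ⇔  12νk ≤ A(k+1)(1 − e^{−x}) (times r^k ≥ 0)
  rw [hGt, hB]
  have hsplit : exp (-(ν * (k : ℝ) * t)) = exp (-(ν * (k : ℝ) ^ 2 * t)) * exp (ν * ((k : ℝ) ^ 2 - k) * t) := by
    rw [← exp_add]; congr 1; ring
  rw [hsplit]
  have hrk : 0 ≤ r ^ k := pow_nonneg hr k
  have hE2 : 0 < exp (ν * ((k : ℝ) ^ 2 - k) * t) := exp_pos _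
  have hν0 : ν ≠ 0 := hν.ne'
  -- reduce to hcond
  have key : A * (k : ℝ) * r ^ k ≤ (1 - exp (-x)) * (A ^ 2 * ((k : ℝ) + 1) * r ^ k / (12 * ν)) := by
    rw [hx]
    have h1 : A * (k : ℝ) * r ^ k * (12 * ν) ≤ (1 - exp (-(ν * ((k : ℝ) ^ 2 - k) * τ))) * (A ^ 2 * ((k : ℝ) + 1) * r ^ k) := by
      have := mul_le_mul_of_nonneg_left hcond (mul_nonneg hA.le hrk)
      nlinarith
    rw [← mul_div_assoc, le_div_iff₀ (by positivity)]
    linarith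
  calc A * (k : ℝ) * r ^ k * (exp (-(ν * (k : ℝ) ^ 2 * t)) * exp (ν * ((k : ℝ) ^ 2 - k) * t))
      = (exp (-(ν * (k : ℝ) ^ 2 * t)) * exp (ν * ((k : ℝ) ^ 2 - k) * t)) * (A * (k : ℝ) * r ^ k) := by ring
    _ ≤ (exp (-(ν * (k : ℝ) ^ 2 * t)) * exp (ν * ((k : ℝ) ^ 2 - k) * t))
          * ((1 - exp (-x)) * (A ^ 2 * ((k : ℝ) + 1) * r ^ k / (12 * ν))) :=
        mul_le_mul_of_nonneg_left key (by positivity)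
    _ = exp (-(ν * (k : ℝ) ^ 2 * t)) * ((1 - exp (-x)) * (A ^ 2 * ((k : ℝ) + 1) * r ^ k / (12 * ν)
          * exp (ν * ((k : ℝ) ^ 2 - k) * t))) := by ring

/-- **TAIL INDUCTION.** Let `0 < L`, `0 < A` with `12ν ≤ A(1 − e^{−L})`, `0 ≤ r`, `0 ≤ α`, `1 ≤ k₀`. If the modes `j ≤ k₀`
satisfy `A j r^j e^{−νjs} ≤ e_j(s)` on `[α, T]`, then EVERY mode `k` satisfies `A k r^k e^{−νkt} ≤ e_k(t)` on
`[α + L/(νk₀), T]` (windows `L/(νk(k−1))` for `k > k₀` telescope to `L/(νk₀)`). [new here — MODEL] -/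
theorem tail_induction (he : IsSineCascade ν c e) (hν : 0 < ν) (hc : 0 ≤ c) {A r α T L : ℝ} (hA : 0 < A) (hr : 0 ≤ r)
    (hα : 0 ≤ α) (hL : 0 < L) (hAL : 12 * ν ≤ A * (1 - exp (-L))) {k₀ : ℕ} (hk₀ : 1 ≤ k₀)
    (base : ∀ j, j ≤ k₀ → ∀ s ∈ Icc α T, A * (j : ℝ) * r ^ j * exp (-(ν * (j : ℝ) * s)) ≤ e j s) :
    ∀ k : ℕ, ∀ t ∈ Icc (α + L / (ν * (k₀ : ℝ))) T, A * (k : ℝ) * r ^ k * exp (-(ν * (k : ℝ) * t)) ≤ e k t := by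
  have hk₀pos : (0 : ℝ) < k₀ := by exact_mod_cast hk₀
  -- P(k): all modes ≤ k dominate on [α_k, T], α_k = α + (L/ν)(1/k₀ − 1/k), for k ≥ k₀
  have P : ∀ k : ℕ, k₀ ≤ k → ∀ j, j ≤ k → ∀ s ∈ Icc (α + L / ν * (1 / (k₀ : ℝ) - 1 / (k : ℝ))) T,
      A * (j : ℝ) * r ^ j * exp (-(ν * (j : ℝ) * s)) ≤ e j s := by
    intro k hk
    induction k, hk using Nat.le_induction with
    | base =>
      intro j hj s hs
      refine base j hj s ⟨?_, hs.2⟩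
      have : α + L / ν * (1 / (k₀ : ℝ) - 1 / (k₀ : ℝ)) = α := by ring
      linarith [hs.1]
    | succ n hn ih =>
      intro j hj s hs
      have hnpos : (0 : ℝ) < n := by exact_mod_cast (lt_of_lt_of_le (by omega : 0 < k₀) hn)
      -- window start for n+1 is later than for n
      have hτ : 0 < L / (ν * ((n : ℝ) + 1) * (n : ℝ)) := by positivity
      have hstep : α + L / ν * (1 / (k₀ : ℝ) - 1 / ((n + 1 : ℕ) : ℝ))
          = (α + L / ν * (1 / (k₀ : ℝ) - 1 / (n : ℝ))) + L / (ν * ((n : ℝ) + 1) * (n : ℝ)) := by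
        have hν0 : ν ≠ 0 := hν.ne'
        have hn0 : (n : ℝ) ≠ 0 := hnpos.ne'
        push_cast
        field_simp
        ring
      rcases Nat.lt_or_ge j (n + 1) with hlt | hge
      · refine ih j (by omega) s ⟨?_, hs.2⟩
        rw [hstep] at hs
        linarith [hs.1, hτ.le]
      · have hjn : j = n + 1 := le_antisymm hj hge
        subst hjn
        have hαn : 0 ≤ α + L / ν * (1 / (k₀ : ℝ) - 1 / (n : ℝ)) := by
          have h1 : 1 / (n : ℝ) ≤ 1 / (k₀ : ℝ) := one_div_le_one_div_of_le hk₀pos (by exact_mod_cast hn)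
          have h2 : 0 ≤ L / ν := div_nonneg hL.le hν.le
          nlinarith
        have hcond : 12 * ν * (((n + 1 : ℕ) : ℝ)) ≤ A * ((((n + 1 : ℕ) : ℝ)) + 1)
            * (1 - exp (-(ν * ((((n + 1 : ℕ) : ℝ)) ^ 2 - ((n + 1 : ℕ) : ℝ)) * (L / (ν * ((n : ℝ) + 1) * (n : ℝ)))))) := by
          have hx : ν * ((((n + 1 : ℕ) : ℝ)) ^ 2 - ((n + 1 : ℕ) : ℝ)) * (L / (ν * ((n : ℝ) + 1) * (n : ℝ))) = L := by
            have hν0 : ν ≠ 0 := hν.ne'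
            have hn0 : (n : ℝ) ≠ 0 := hnpos.ne'
            push_cast
            field_simp
            ring
          rw [hx]
          have hm : (0 : ℝ) ≤ ((n + 1 : ℕ) : ℝ) := by positivity
          have h1 : 0 ≤ 1 - exp (-L) := by
            have : exp (-L) ≤ 1 := exp_le_one_iff.mpr (by linarith)
            linarith
          -- 12ν(n+1) ≤ A(1−e^{−L})(n+1) ≤ A(n+2)(1−e^{−L})
          have h2 := mul_le_mul_of_nonneg_right hAL hm
          nlinarith [mul_nonneg hA.le h1]
        have := tail_step he hν hc hA hr hαn hτ (k := n + 1) (by omega) hcond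
          (fun i hi s' hs' => ih i (by omega) s' hs') s (by rw [hstep] at hs; exact hs)
        exact this
  intro k t ht
  rcases Nat.lt_or_ge k₀ k with hlt | hge
  · refine P k hlt.le k le_rfl t ⟨?_, ht.2⟩
    have hkpos : (0 : ℝ) < k := by exact_mod_cast (lt_of_lt_of_le (by omega : 0 < k₀) hlt.le)
    have h1 : L / ν * (1 / (k₀ : ℝ) - 1 / (k : ℝ)) ≤ L / (ν * (k₀ : ℝ)) := by
      have hν0 : ν ≠ 0 := hν.ne'
      have hk0' : (k₀ : ℝ) ≠ 0 := hk₀pos.ne'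
      have hk' : (k : ℝ) ≠ 0 := hkpos.ne'
      have e1 : L / ν * (1 / (k₀ : ℝ) - 1 / (k : ℝ)) = L / (ν * (k₀ : ℝ)) - L / (ν * (k : ℝ)) := by
        field_simp
      have e2 : 0 ≤ L / (ν * (k : ℝ)) := by positivity
      linarith
    linarith [ht.1]
  · exact base k hge t ⟨by linarith [ht.1, (by positivity : 0 ≤ L / (ν * (k₀ : ℝ)))], ht.2⟩

/-- **BLOW-UP FROM A CERTIFIED BASE.** Under the hypotheses of `tail_induction`, if `t₁ := α + L/(νk₀) ≤ T` and
`1 ≤ r e^{−νt₁}`, then `k ↦ c_k(t₁)` is unbounded (`c_k(t₁) ≥ A k`): no solution with bounded Fourier coefficients survives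
to `t₁`. [new here — MODEL] -/
theorem unbounded_of_base (he : IsSineCascade ν c e) (hν : 0 < ν) (hc : 0 ≤ c) {A r α T L : ℝ} (hA : 0 < A) (hr : 0 ≤ r)
    (hα : 0 ≤ α) (hL : 0 < L) (hAL : 12 * ν ≤ A * (1 - exp (-L))) {k₀ : ℕ} (hk₀ : 1 ≤ k₀)
    (base : ∀ j, j ≤ k₀ → ∀ s ∈ Icc α T, A * (j : ℝ) * r ^ j * exp (-(ν * (j : ℝ) * s)) ≤ e j s)
    (hT : α + L / (ν * (k₀ : ℝ)) ≤ T) (hrt : 1 ≤ r * exp (-(ν * (α + L / (ν * (k₀ : ℝ)))))) :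
    ∀ M : ℝ, ∃ k : ℕ, M < e k (α + L / (ν * (k₀ : ℝ))) := by
  intro M
  set t₁ := α + L / (ν * (k₀ : ℝ)) with ht₁
  obtain ⟨k, hk⟩ := exists_nat_gt (M / A)
  refine ⟨k, lt_of_lt_of_le ?_ (tail_induction he hν hc hA hr hα hL hAL hk₀ base k t₁ ⟨le_rfl, hT⟩)⟩
  have hq : (1 : ℝ) ≤ (r * exp (-(ν * t₁))) ^ k := one_le_pow₀ hrt
  have hid : A * (k : ℝ) * r ^ k * exp (-(ν * (k : ℝ) * t₁)) = A * (k : ℝ) * (r * exp (-(ν * t₁))) ^ k := by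
    rw [mul_pow, ← exp_nat_mul]; ring_nf
  rw [hid]
  have hM : M < A * (k : ℝ) := by rw [div_lt_iff₀ hA] at hk; linarith
  nlinarith [mul_le_mul_of_nonneg_left hq (by positivity : (0:ℝ) ≤ A * (k : ℝ))]

end SheetNSLineTorusCascade
end Summit.NavierStokesRegularity.OSWSelfSimilar
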